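import Summits.ValiantsHypothesis.ValiantsHypothesis.Theorems.ToricFixedPoints.Negative.FormDeborderingPaddedEndIffDc

/-!
# `ToricFixedPoints` / line `form_then_lift`, stub F1: the exact End-window of the padded `G₃`

`paddedG3_mem_endOrbit_iff`: for `m ≥ 4`, `ℓ^{m-3}·G₃(Y) ∈ End(ℂ^{m²})·det_m ↔ 7 ≤ m`
(`dc(G₃) = 7`, `FormDeborderingG3Dc`, through the dictionary `FormDeborderingPaddedEndIffDc`).  So the
`G₃` family is F1-positive outright for every `m ≥ 7` (End-type ⇒ toric, `FormDeborderingEndType`),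
excluded for `m ≤ 4` (not even a border point, LMR dual criterion), and can bear on F1 only at
`m ∈ {5, 6}` — where it does so iff `ℓ^{m-3}G₃` is a border point, i.e. iff `bdc(x₁x₂x₃+x₄x₅x₆+x₇x₈x₉) ≤ m`
(open; numerically false at both sizes, kit job j294074).  Supersedes the one-directional
`FormDeborderingG3NotEnd`.  Refuter/theory seat `val-width-5779-d1` (stmt-ValiantsHypothesis-5779).
VP ≠ VNP is not touched.
-/

open MvPolynomial Finset
open Literature.Computability.AlgebraicComplexity

namespace Summit.ValiantsHypothesis.Cruxes.ToricFixedPoints.Negative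

/-- **End-window of the padded `G₃`.**  `m ≥ 4`: `ℓ^{m-3}(y₀₀y₁₁y₂₂ + y₀₁y₁₂y₂₀ + y₀₂y₁₀y₂₁) ∈ End·det_m ↔ 7 ≤ m`.
[folklore] -/
theorem paddedG3_mem_endOrbit_iff (m : ℕ) [NeZero m] (hm : 4 ≤ m) :
    let y : Fin 3 → Fin 3 → MvPolynomial (Fin m × Fin m) ℂ :=
      fun a b => X (⟨m - 3 + a, by omega⟩, ⟨m - 3 + b, by omega⟩)
    X ((0 : Fin m), (0 : Fin m)) ^ (m - 3) *
        (y 0 0 * y 1 1 * y 2 2 + y 0 1 * y 1 2 * y 2 0 + y 0 2 * y 1 0 * y 2 1) ∈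
      endOrbit (Fin m × Fin m) ℂ (detPoly (Fin m) ℂ) ↔ 7 ≤ m := by
  intro y
  have h := paddedBlock3_mem_endOrbit_iff_dc_le m hm (s := 3) (by omega) _ (G3_isHomogeneous (K := ℂ))
  rw [determinantalComplexity_G3 ℂ] at h
  simp only [map_add, map_mul, aeval_X] at h
  exact h

end Summit.ValiantsHypothesis.Cruxes.ToricFixedPoints.Negative
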